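import Summits.Ventures.CertifiedManyBodySolver.Rows.DopedTLCorrBundleWND
import Literature.MathematicalPhysics.QuantumLattice.HubbardOneBodyKinematicRows
import HarnessLib

/-!
# The PINNED U-PAIR shape: two per-vertex certificate rows sharing their equation-of-motion functional, and the
# DOCC-BOX bundle row (`WND`) it yields BY THEOREM — the boxdual reader's covariance-box law at the level of states
# (cell `pub/hubbard-obs`, D-0154 (1)(C) COVERAGE Hg-1201; seat `hubbard-cov-hg1201-box-1`, lineage desk)

HONEST FRAMING: NOTHING IS ASSERTED HERE: one `def … : Prop` (a claim-node SHAPE) and solver-free theorems; no `sorry`, no named fact, zero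
compute. Companion of `Rows/DopedTLCorrBundleWN.lean` / `…WND.lean` (same seat) and of `Literature/Computation/Certificates/CovarianceBoxCertificate.lean`
(the model-free per-vertex rule, `CovarianceBox.sum_mul_sub_cov_le` / `segment_convexFloor_le`).

WHY. A DERIVED-edition DOCC-BOX node (`Certificates/HubbardSquare_Hg1201_pinU_*_dext183q_WND.lean`, p642073 / p642088; the coming M19 / @10 U-cells) records the
OUTPUT `F0` of the boxdual law applied to a PINNED U-pair {A = hub′, B = spoke′}: two `certsdp-cert/0` certificates at `U_A < U_B` (same `t′ = s`, same density `n₀`,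
same objective) whose equation-of-motion multipliers COINCIDE (the spoke is solved with the hub's eom multipliers pinned; `pinfold` verdict), and which differ only
in their two `le`-row multipliers `κ = (κ_cap, κ_cut)`, their two `expect`-row multipliers (filling slope `sl = ½Σλ`) and their PSD blocks. Until now the passage
{two certificates} ↦ {cell row} lived in three python lineages (+ the kernel check of its last mile, `…_WND_Derivation.lean`). THIS FILE types the passage itself:

* §A the SHAPE `SquareTTPrimePinnedPairRowU UA UB s cA cB flA flB βA κA κA' slA βB κB κB' slB n₀ S Λ X` — what the two certificates + the pinning establish AT
  THE LEVEL OF STATES: there are two real functionals `E₀, E₁` of the infinite-volume state (the shared eom penalty split as `Σ_k m_k ω([H₀, O_k]) + U·Σ_k m_k ω([D, O_k])`)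
  such that for every `U ∈ [UA, UB]`, every density `x ∈ [0, 2)` and every torus limit `ω` of unit sector ground states at `(s, U, x)`:
  (E) `E₀ ω + U·E₁ ω = 0` (stationarity of a ground state under ITS OWN Hamiltonian);
  (V_A) `βA + κA·(cA − e + (U − UA)·D ω) + κA'·(e − (U − UA)·D ω − flA) + slA·(x − n₀) + E₀ ω + UA·E₁ ω ≤ X̄ ω` — weak duality of certificate A evaluated on the
  (symmetrised) moments of `ω`: its cap / cut rows see the energy functional WITH COEFFICIENT `UA`, i.e. `e − (U − UA)·D ω` (`e = e₀(1, s, U, x)` the ground-state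
  energy density, `D ω` the double-occupancy density), its density rows see `x`, its eom rows see `H_{UA} = H₀ + UA·D`, its PSD penalties are `≥ 0` and dropped;
  (V_B) the same for B. (`X̄ ω = |S|⁻¹ Σ_{γ∈S} Re ω_{γΛ}(Γ X)`, the `D₄`-orbit mean the reduced program bounds.)
* §B edges: re-pricing the caps (`β ↦ β − κ_cap·(c″ − c)`, an identity row by row — `le_reprice`), and β-monotonicity;
* §C **PINNED PAIR ⇒ DOCC-BOX BUNDLE ROW.** For `UA < UB`, `κ ≥ 0`, any docc literal `dhi`, window functions under the chords, division-free (`(UB − UA)·cap U s ≤ (UB − U)cA + (U − UA)cB`,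
  `(UB − U)flA + (U − UA)flB ≤ (UB − UA)·flo U s`) and ANY `F` below the segment parabola (`w = (U − UA)/(UB − UA)`)
  `(1 − w)βA + wβB − w(1 − w)·L`, `L = (UB − UA)·max((Δκ_cap − Δκ_cut)·0, (Δκ_cap − Δκ_cut)·dhi) − (Δκ_cap·(cB − cA) + Δκ_cut·(−(flB − flA)))` (`Δ = B − A`) on `w ∈ [0, 1]`:
  `SquareTTPrimeBundleOrbitLowerRowWND UA UB s s flo cap dhi F slA slB n₀ S Λ X`. Proof = the reader's law, line by line: convex combination `(1 − w)·(V_A) + w·(V_B)`,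
  (E) kills the eom part at the barycentre, the combined `le` multipliers times the window slacks are `≥ 0` up to the constant covariance `w(1 − w)·d`, the docc
  coefficient `−w(1 − w)·ΔU·(Δκ_cap − Δκ_cut)·D ω` is priced on the box `D ω ∈ [0, dhi]` (`IsTorusLimitOf.docc_nonneg` + the WND premise), and the combined filling slope
  dominates `wnBundleValue`'s `min`;
* §D the two floor kinds of the reader as corollaries: INTERIOR (`0 < L`: `F ≤ βA − (L − g)²/(4L)`, completed square) and VERTEX (`F ≤ min βA βB` when `L ≤ 0`).

So a pinned-pair claim node (per-vertex literals `β, κ, sl, c` = what `verify_min` + the cert bytes show, plus the pinning) yields the cell's WND node as a THEOREM,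
with `F0`, `L`, `d`, the load-bearing end of the docc box and the floor kind all kernel-checked — the derived edition without a deriver.
WHAT THIS IS NOT: a soundness theorem for the reduced moment program (the shape is a CLAIM about states, justified outside Lean by the two certificates, the
`D₄`/translation averaging of moment vectors and the pinfold verdict); a statement that any pair has printed; a number. CONTROL / CALIBRATION wording class (xx1).

References: D. P. Bertsekas, *Nonlinear Programming*, 2nd ed. (1999), Prop. 5.1.3 [Bertsekas1999NonlinearProgramming]; S. Boyd, L. Vandenberghe,
*Convex Optimization* (2004) §5.9 [BoydVandenberghe2004]; J. Wang et al., PRX 14 (2024) 031006, §III [WangEtAl2024].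
-/

noncomputable section

namespace Summit.Ventures.CertifiedManyBodySolver

open Literature.MathematicalPhysics.QuantumLattice
open Matrix HubbardWave0 Literature.Probability.LatticeModels ThermodynamicLimit Filter Topology
open Summit.Ventures.CertifiedManyBodySolver.Downfold (wnBundleValue)
open scoped BigOperators ComplexOrder

/-! ## §A  The pinned U-pair row SHAPE (state level) -/

section Defs

/-- §A **PINNED U-PAIR ROW SHAPE** `SquareTTPrimePinnedPairRowU UA UB s cA cB flA flB βA κA κA' slA βB κB κB' slB n₀ S Λ X`. Square lattice `ℤ²`, `t = 1`, fixed
`t′ = s`; two certificate vertices `U = UA` (data `βA` = certified bound, `κA`, `κA'` = cap-row and cut-row multipliers, `slA` = filling slope, cap rhs `cA`, cut floor `flA`) and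
`U = UB` (the same with `B`), solved at density `n₀` with SHARED equation-of-motion multipliers: there exist real functionals `E₀ E₁` of the state such that for every
`U ∈ [UA, UB]`, `x ∈ [0, 2)` and every torus limit `ω` of unit ground states of the sectors `(rectN x L_j, S^z = 0)` of `hubbardTorusTT' L_j 1 s U`: (E) `E₀ ω + U·E₁ ω = 0`;
(V_A) `βA + κA(cA − e + (U − UA)D) + κA'(e − (U − UA)D − flA) + slA(x − n₀) + E₀ ω + UA·E₁ ω ≤ X̄ ω`; (V_B) likewise — with `e = energyDensityTT' 1 s U x`,
`D = ω.meanEnergy (hubbardTTPrimeFermionInteraction 0 0 1) 1`, `X̄ ω = |S|⁻¹ Σ_{γ ∈ S} Re ω_{γΛ}(Γ(d4Emb γ 0) X)`. [cite: Bertsekas1999NonlinearProgramming, Prop. 5.1.3]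
[cite: BoydVandenberghe2004, §5.9] -/
def SquareTTPrimePinnedPairRowU (UA UB s : ℝ) (cA cB flA flB : ℚ) (βA κA κA' slA βB κB κB' slB n₀ : ℚ)
    (S : Finset (DihedralGroup 4)) (Λ : Finset (Site 2)) (X : FermionOp Λ) : Prop :=
  ∃ E₀ E₁ : InfVolFermionState 2 → ℝ,
    ∀ U ∈ Set.Icc UA UB, ∀ x : ℝ, 0 ≤ x → x < 2 →
      ∀ (ω : InfVolFermionState 2) (Ls : ℕ → ℕ) (ψ : ∀ L, Fock (Orb (FermionTorus 2 L))),
        Tendsto Ls atTop atTop →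
        (∀ j, IsGroundStateInSector (hubbardTorusTT' (Ls j) 1 s U) (rectN x (Ls j)) 0 (ψ (Ls j))) →
        (∀ j, star (ψ (Ls j)) ⬝ᵥ ψ (Ls j) = 1) → ω.IsTorusLimitOf ψ Ls →
        (E₀ ω + U * E₁ ω = 0) ∧
        (((βA : ℚ) : ℝ) + ((κA : ℚ) : ℝ) * (((cA : ℚ) : ℝ) - energyDensityTT' 1 s U x + (U - UA) * ω.meanEnergy (hubbardTTPrimeFermionInteraction 0 0 1) 1) +
            ((κA' : ℚ) : ℝ) * (energyDensityTT' 1 s U x - (U - UA) * ω.meanEnergy (hubbardTTPrimeFermionInteraction 0 0 1) 1 - ((flA : ℚ) : ℝ)) +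
            ((slA : ℚ) : ℝ) * (x - ((n₀ : ℚ) : ℝ)) + E₀ ω + UA * E₁ ω ≤
          (S.card : ℝ)⁻¹ * ∑ g ∈ S, (ω.expect (d4ShiftSet g 0 Λ) (fermionEmbed (PolySite.d4Emb g 0 Λ) X)).re) ∧
        (((βB : ℚ) : ℝ) + ((κB : ℚ) : ℝ) * (((cB : ℚ) : ℝ) - energyDensityTT' 1 s U x + (U - UB) * ω.meanEnergy (hubbardTTPrimeFermionInteraction 0 0 1) 1) +
            ((κB' : ℚ) : ℝ) * (energyDensityTT' 1 s U x - (U - UB) * ω.meanEnergy (hubbardTTPrimeFermionInteraction 0 0 1) 1 - ((flB : ℚ) : ℝ)) +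
            ((slB : ℚ) : ℝ) * (x - ((n₀ : ℚ) : ℝ)) + E₀ ω + UB * E₁ ω ≤
          (S.card : ℝ)⁻¹ * ∑ g ∈ S, (ω.expect (d4ShiftSet g 0 Λ) (fermionEmbed (PolySite.d4Emb g 0 Λ) X)).re)

end Defs

/-! ## §B  Solver-free edges -/

section Edges

variable {UA UB s : ℝ} {cA cB flA flB βA κA κA' slA βB κB κB' slB n₀ : ℚ} {S : Finset (DihedralGroup 4)}
  {Λ : Finset (Site 2)} {X : FermionOp Λ}

/-- **Re-pricing the caps** (`le_reprice`): with the SAME multipliers, moving the cap rhs from `c` to `c″` at either vertex and the bound from `β` to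
`β − κ_cap·(c″ − c)` leaves every vertex row UNCHANGED (an identity: `β − κ(c″ − c) + κ(c″ − ·) = β + κ(c − ·)`); this is how a node BOOKED at a looser window
than the leg was solved at is priced (`β′ = b − κ_cap·(c_node − c_solved)`; the looser window then enters through `bundleWND`'s chord condition).
[cite: BoydVandenberghe2004, §5.9] -/
theorem SquareTTPrimePinnedPairRowU.reprice
    (h : SquareTTPrimePinnedPairRowU UA UB s cA cB flA flB βA κA κA' slA βB κB κB' slB n₀ S Λ X) (cA'' cB'' : ℚ) :
    SquareTTPrimePinnedPairRowU UA UB s cA'' cB'' flA flB (βA - κA * (cA'' - cA)) κA κA' slA (βB - κB * (cB'' - cB)) κB κB' slB n₀ S Λ X := by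
  obtain ⟨E₀, E₁, hh⟩ := h
  refine ⟨E₀, E₁, fun U hU x hx0 hx2 ω Ls ψ hLs hψ hψ1 hω => ?_⟩
  obtain ⟨hE, hVA, hVB⟩ := hh U hU x hx0 hx2 ω Ls ψ hLs hψ hψ1 hω
  set e : ℝ := energyDensityTT' 1 s U x with he
  set D : ℝ := ω.meanEnergy (hubbardTTPrimeFermionInteraction 0 0 1) 1 with hD
  refine ⟨hE, ?_, ?_⟩
  · have key : (((βA - κA * (cA'' - cA) : ℚ)) : ℝ) + ((κA : ℚ) : ℝ) * (((cA'' : ℚ) : ℝ) - e + (U - UA) * D) =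
        ((βA : ℚ) : ℝ) + ((κA : ℚ) : ℝ) * (((cA : ℚ) : ℝ) - e + (U - UA) * D) := by
      push_cast; ring
    linarith [hVA, key]
  · have key : (((βB - κB * (cB'' - cB) : ℚ)) : ℝ) + ((κB : ℚ) : ℝ) * (((cB'' : ℚ) : ℝ) - e + (U - UB) * D) =
        ((βB : ℚ) : ℝ) + ((κB : ℚ) : ℝ) * (((cB : ℚ) : ℝ) - e + (U - UB) * D) := by
      push_cast; ring
    linarith [hVB, key]

/-- β-monotonicity: the shape survives any SMALLER vertex bounds `βA'' ≤ βA`, `βB'' ≤ βB`. [folklore] -/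
theorem SquareTTPrimePinnedPairRowU.mono
    (h : SquareTTPrimePinnedPairRowU UA UB s cA cB flA flB βA κA κA' slA βB κB κB' slB n₀ S Λ X)
    {βA'' βB'' : ℚ} (hA : βA'' ≤ βA) (hB : βB'' ≤ βB) :
    SquareTTPrimePinnedPairRowU UA UB s cA cB flA flB βA'' κA κA' slA βB'' κB κB' slB n₀ S Λ X := by
  obtain ⟨E₀, E₁, hh⟩ := h
  refine ⟨E₀, E₁, fun U hU x hx0 hx2 ω Ls ψ hLs hψ hψ1 hω => ?_⟩
  obtain ⟨hE, hVA, hVB⟩ := hh U hU x hx0 hx2 ω Ls ψ hLs hψ hψ1 hω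
  have hA' : ((βA'' : ℚ) : ℝ) ≤ ((βA : ℚ) : ℝ) := by exact_mod_cast hA
  have hB' : ((βB'' : ℚ) : ℝ) ≤ ((βB : ℚ) : ℝ) := by exact_mod_cast hB
  exact ⟨hE, by linarith, by linarith⟩

end Edges

/-! ## §C  PINNED PAIR ⇒ the DOCC-BOX bundle row (the boxdual covariance-box law, at the level of states) -/

section Law

variable {UA UB s : ℝ} {cA cB flA flB βA κA κA' slA βB κB κB' slB n₀ : ℚ} {S : Finset (DihedralGroup 4)}
  {Λ : Finset (Site 2)} {X : FermionOp Λ}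

/-- An affine function of `D` on a box is below its larger end value: `a·D ≤ max (a·lo) (a·hi)` for `D ∈ [lo, hi]`. [folklore] -/
theorem mul_le_max_mul_ends (a lo hi D : ℝ) (h₁ : lo ≤ D) (h₂ : D ≤ hi) : a * D ≤ max (a * lo) (a * hi) := by
  rcases le_total 0 a with ha | ha
  · exact (mul_le_mul_of_nonneg_left h₂ ha).trans (le_max_right _ _)
  · exact (mul_le_mul_of_nonpos_left h₁ ha).trans (le_max_left _ _)

/-- `wnBundleValue` is dominated by ANY convex combination of its two slope branches. [folklore] -/
theorem wnBundleValue_le_convexComb (F sl₁ sl₂ n₀ : ℚ) (x w : ℝ) (hw0 : 0 ≤ w) (hw1 : w ≤ 1) :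
    wnBundleValue F sl₁ sl₂ n₀ x ≤
      ((F : ℚ) : ℝ) + ((1 - w) * ((sl₁ : ℚ) : ℝ) + w * ((sl₂ : ℚ) : ℝ)) * (x - ((n₀ : ℚ) : ℝ)) := by
  unfold wnBundleValue
  have h1 := min_le_left (((sl₁ : ℚ) : ℝ) * (x - ((n₀ : ℚ) : ℝ))) (((sl₂ : ℚ) : ℝ) * (x - ((n₀ : ℚ) : ℝ)))
  have h2 := min_le_right (((sl₁ : ℚ) : ℝ) * (x - ((n₀ : ℚ) : ℝ))) (((sl₂ : ℚ) : ℝ) * (x - ((n₀ : ℚ) : ℝ)))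
  nlinarith [mul_le_mul_of_nonneg_left h1 (sub_nonneg.2 hw1), mul_le_mul_of_nonneg_left h2 hw0]

/-- **PINNED U-PAIR ⇒ DOCC-BOX BUNDLE ROW** (the boxdual reader's covariance-box law as a theorem about states). Data: `UA < UB`; multipliers `κ ≥ 0`; a docc
literal `dhi` (any: the box `[0, dhi]` is priced at its worse end); window FUNCTIONS under the chords of the vertex rhs, stated division-free (`(UB − UA)·cap U s' ≤ (UB − U)·cA + (U − UA)·cB`,
`(UB − U)·flA + (U − UA)·flB ≤ (UB − UA)·flo U s'` — equalities for the affine interpolants); and a slot `F` below the segment parabola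
`(1 − w)βA + wβB − w(1 − w)·L` for all `w ∈ [0, 1]` (`w = (U − UA)/(UB − UA)`), where
`L = (UB − UA)·max((Δκ_cap − Δκ_cut)·0, (Δκ_cap − Δκ_cut)·dhi) − (Δκ_cap·(cB − cA) + Δκ_cut·(−(flB − flA)))`, `Δ = B − A`. Then
`SquareTTPrimeBundleOrbitLowerRowWND UA UB s s flo cap dhi F slA slB n₀ S Λ X`. [cite: Bertsekas1999NonlinearProgramming, Prop. 5.1.3] [cite: BoydVandenberghe2004, §5.9]
[cite: WangEtAl2024, §III] -/
theorem SquareTTPrimePinnedPairRowU.bundleWND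
    (h : SquareTTPrimePinnedPairRowU UA UB s cA cB flA flB βA κA κA' slA βB κB κB' slB n₀ S Λ X)
    (hAB : UA < UB) (hκA : 0 ≤ κA) (hκA' : 0 ≤ κA') (hκB : 0 ≤ κB) (hκB' : 0 ≤ κB')
    {flo cap : ℝ → ℝ → ℝ} {dhi F : ℚ}
    (hcap : ∀ U ∈ Set.Icc UA UB, ∀ s' ∈ Set.Icc s s, (UB - UA) * cap U s' ≤ (UB - U) * ((cA : ℚ) : ℝ) + (U - UA) * ((cB : ℚ) : ℝ))
    (hflo : ∀ U ∈ Set.Icc UA UB, ∀ s' ∈ Set.Icc s s, (UB - U) * ((flA : ℚ) : ℝ) + (U - UA) * ((flB : ℚ) : ℝ) ≤ (UB - UA) * flo U s')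
    (hF : ∀ w : ℝ, 0 ≤ w → w ≤ 1 →
      ((F : ℚ) : ℝ) ≤ (1 - w) * ((βA : ℚ) : ℝ) + w * ((βB : ℚ) : ℝ) -
        w * (1 - w) * ((UB - UA) * max ((((κB - κA) - (κB' - κA') : ℚ) : ℝ) * 0) ((((κB - κA) - (κB' - κA') : ℚ) : ℝ) * ((dhi : ℚ) : ℝ)) -
          ((((κB - κA) * (cB - cA) + (κB' - κA') * (-(flB - flA)) : ℚ)) : ℝ))) :
    SquareTTPrimeBundleOrbitLowerRowWND UA UB s s flo cap dhi F slA slB n₀ S Λ X := by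
  obtain ⟨E₀, E₁, hh⟩ := h
  intro U hU s' hs' x hx0 hx2 ω Ls ψ hLs hψ hψ1 hω hl hu hdocc
  have hss : s' = s := le_antisymm hs'.2 hs'.1
  have hcapU := hcap U hU s' hs'
  have hfloU := hflo U hU s' hs'
  subst s'
  obtain ⟨hE, hVA, hVB⟩ := hh U hU x hx0 hx2 ω Ls ψ hLs hψ hψ1 hω
  -- abbreviations
  set e : ℝ := energyDensityTT' 1 s U x with he
  set D : ℝ := ω.meanEnergy (hubbardTTPrimeFermionInteraction 0 0 1) 1 with hD
  set Xbar : ℝ := (S.card : ℝ)⁻¹ * ∑ g ∈ S, (ω.expect (d4ShiftSet g 0 Λ) (fermionEmbed (PolySite.d4Emb g 0 Λ) X)).re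
    with hXbar
  have hΔ : 0 < UB - UA := sub_pos.2 hAB
  -- the barycentric weight
  set w : ℝ := (U - UA) / (UB - UA) with hw
  have hw0 : 0 ≤ w := div_nonneg (sub_nonneg.2 hU.1) hΔ.le
  have hw1 : w ≤ 1 := by rw [hw, div_le_one hΔ]; linarith [hU.2]
  have hUw : U = UA + w * (UB - UA) := by rw [hw]; field_simp; ring
  have e1 : UB - U = (1 - w) * (UB - UA) := by rw [hUw]; ring
  have e2 : U - UA = w * (UB - UA) := by rw [hUw]; ring
  -- the window rows at the barycentre lie inside the chords of the vertex rhs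
  have hcapw : cap U s ≤ (1 - w) * ((cA : ℚ) : ℝ) + w * ((cB : ℚ) : ℝ) := by
    have h' := hcapU
    rw [e1, e2] at h'
    exact le_of_mul_le_mul_left (h'.trans (le_of_eq (by ring))) hΔ
  have hflow : (1 - w) * ((flA : ℚ) : ℝ) + w * ((flB : ℚ) : ℝ) ≤ flo U s := by
    have h' := hfloU
    rw [e1, e2] at h'
    exact le_of_mul_le_mul_left ((le_of_eq (by ring)).trans h') hΔ
  -- docc box
  have hD0 : 0 ≤ D := hω.docc_nonneg hLs
  have hDhi : D ≤ ((dhi : ℚ) : ℝ) := hdocc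
  -- signs
  have hκA0 : (0 : ℝ) ≤ ((κA : ℚ) : ℝ) := by exact_mod_cast hκA
  have hκA0' : (0 : ℝ) ≤ ((κA' : ℚ) : ℝ) := by exact_mod_cast hκA'
  have hκB0 : (0 : ℝ) ≤ ((κB : ℚ) : ℝ) := by exact_mod_cast hκB
  have hκB0' : (0 : ℝ) ≤ ((κB' : ℚ) : ℝ) := by exact_mod_cast hκB'
  -- (1) convex combination of the two vertex rows
  have h1 : (1 - w) * (((βA : ℚ) : ℝ) + ((κA : ℚ) : ℝ) * (((cA : ℚ) : ℝ) - e + (U - UA) * D) +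
      ((κA' : ℚ) : ℝ) * (e - (U - UA) * D - ((flA : ℚ) : ℝ)) + ((slA : ℚ) : ℝ) * (x - ((n₀ : ℚ) : ℝ)) + E₀ ω + UA * E₁ ω) +
      w * (((βB : ℚ) : ℝ) + ((κB : ℚ) : ℝ) * (((cB : ℚ) : ℝ) - e + (U - UB) * D) +
      ((κB' : ℚ) : ℝ) * (e - (U - UB) * D - ((flB : ℚ) : ℝ)) + ((slB : ℚ) : ℝ) * (x - ((n₀ : ℚ) : ℝ)) + E₀ ω + UB * E₁ ω) ≤ Xbar := by
    have a := mul_le_mul_of_nonneg_left hVA (sub_nonneg.2 hw1)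
    have b := mul_le_mul_of_nonneg_left hVB hw0
    linarith [a, b]
  -- (2) the combined cap / cut slacks are nonnegative at the barycentre (window rows under the chords)
  have h2 : 0 ≤ ((1 - w) * ((κA : ℚ) : ℝ) + w * ((κB : ℚ) : ℝ)) *
      ((1 - w) * ((cA : ℚ) : ℝ) + w * ((cB : ℚ) : ℝ) - e) :=
    mul_nonneg (add_nonneg (mul_nonneg (sub_nonneg.2 hw1) hκA0) (mul_nonneg hw0 hκB0)) (by linarith [hu, hcapw])
  have h3 : 0 ≤ ((1 - w) * ((κA' : ℚ) : ℝ) + w * ((κB' : ℚ) : ℝ)) *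
      (e - ((1 - w) * ((flA : ℚ) : ℝ) + w * ((flB : ℚ) : ℝ))) :=
    mul_nonneg (add_nonneg (mul_nonneg (sub_nonneg.2 hw1) hκA0') (mul_nonneg hw0 hκB0')) (by linarith [hl, hflow])
  -- (3) the docc coefficient priced on the box [0, dhi]
  have h4 : ((((κB - κA) - (κB' - κA') : ℚ)) : ℝ) * D ≤ max (((((κB - κA) - (κB' - κA') : ℚ)) : ℝ) * 0) (((((κB - κA) - (κB' - κA') : ℚ)) : ℝ) * ((dhi : ℚ) : ℝ)) :=
    mul_le_max_mul_ends _ 0 _ D hD0 hDhi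
  have h4' : 0 ≤ w * (1 - w) * (UB - UA) := mul_nonneg (mul_nonneg hw0 (sub_nonneg.2 hw1)) hΔ.le
  have h5 := mul_le_mul_of_nonneg_left h4 h4'
  -- (4) the slot is below the parabola at this w, and the combined slope dominates the bundle value
  have h6 := hF w hw0 hw1
  have h7 := wnBundleValue_le_convexComb F slA slB n₀ x w hw0 hw1
  -- (5) the algebraic identity behind the law (U = UA + w ΔU), then (E) kills the eom part
  have key : (1 - w) * (((βA : ℚ) : ℝ) + ((κA : ℚ) : ℝ) * (((cA : ℚ) : ℝ) - e + (U - UA) * D) +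
      ((κA' : ℚ) : ℝ) * (e - (U - UA) * D - ((flA : ℚ) : ℝ)) + ((slA : ℚ) : ℝ) * (x - ((n₀ : ℚ) : ℝ)) + E₀ ω + UA * E₁ ω) +
      w * (((βB : ℚ) : ℝ) + ((κB : ℚ) : ℝ) * (((cB : ℚ) : ℝ) - e + (U - UB) * D) +
      ((κB' : ℚ) : ℝ) * (e - (U - UB) * D - ((flB : ℚ) : ℝ)) + ((slB : ℚ) : ℝ) * (x - ((n₀ : ℚ) : ℝ)) + E₀ ω + UB * E₁ ω) =
      (1 - w) * ((βA : ℚ) : ℝ) + w * ((βB : ℚ) : ℝ) +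
      ((1 - w) * ((slA : ℚ) : ℝ) + w * ((slB : ℚ) : ℝ)) * (x - ((n₀ : ℚ) : ℝ)) +
      (E₀ ω + U * E₁ ω) +
      ((1 - w) * ((κA : ℚ) : ℝ) + w * ((κB : ℚ) : ℝ)) * ((1 - w) * ((cA : ℚ) : ℝ) + w * ((cB : ℚ) : ℝ) - e) +
      ((1 - w) * ((κA' : ℚ) : ℝ) + w * ((κB' : ℚ) : ℝ)) * (e - ((1 - w) * ((flA : ℚ) : ℝ) + w * ((flB : ℚ) : ℝ))) +
      w * (1 - w) * ((((κB - κA) * (cB - cA) + (κB' - κA') * (-(flB - flA)) : ℚ)) : ℝ) -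
      w * (1 - w) * (UB - UA) * (((((κB - κA) - (κB' - κA') : ℚ)) : ℝ) * D) := by
    rw [hUw]; push_cast; ring
  rw [hE] at key
  linarith [h1, h2, h3, h5, h6, h7, key]

end Law

/-! ## §D  The reader's two floor kinds -/

section Kinds

variable {UA UB s : ℝ} {cA cB flA flB βA κA κA' slA βB κB κB' slB n₀ : ℚ} {S : Finset (DihedralGroup 4)}
  {Λ : Finset (Site 2)} {X : FermionOp Λ}

/-- Completed square: for `0 < L`, `βA − (L − (βB − βA))²/(4L) ≤ (1 − w)βA + wβB − w(1 − w)L` for every real `w`. [folklore] -/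
theorem pinnedPair_segFloor_le (βA βB L w : ℝ) (hL : 0 < L) :
    βA - (L - (βB - βA)) ^ 2 / (4 * L) ≤ (1 - w) * βA + w * βB - w * (1 - w) * L := by
  have key : (1 - w) * βA + w * βB - w * (1 - w) * L - (βA - (L - (βB - βA)) ^ 2 / (4 * L)) =
      L * (w - (L - (βB - βA)) / (2 * L)) ^ 2 := by
    field_simp
    ring
  nlinarith [mul_nonneg hL.le (sq_nonneg (w - (L - (βB - βA)) / (2 * L))), key]

/-- Concave / endpoint case: for `L ≤ 0` and `w ∈ [0, 1]`, `min βA βB ≤ (1 − w)βA + wβB − w(1 − w)L`. [folklore] -/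
theorem pinnedPair_endpointFloor_le (βA βB L w : ℝ) (hL : L ≤ 0) (hw0 : 0 ≤ w) (hw1 : w ≤ 1) :
    min βA βB ≤ (1 - w) * βA + w * βB - w * (1 - w) * L := by
  have h1 : min βA βB ≤ βA := min_le_left _ _
  have h2 : min βA βB ≤ βB := min_le_right _ _
  have h3 : 0 ≤ w * (1 - w) := mul_nonneg hw0 (by linarith)
  nlinarith [mul_nonneg h3 (neg_nonneg.2 hL)]

/-- **INTERIOR KIND.** As `bundleWND`, with the slot hypothesis replaced by the reader's interior floor: `0 < L` and `F ≤ βA − (L − (βB − βA))²/(4L)` (the value at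
`x* = (L − g)/(2L)`; valid as a floor whether or not `x* ∈ [0, 1]`). [cite: BoydVandenberghe2004, §5.9] -/
theorem SquareTTPrimePinnedPairRowU.bundleWND_interior
    (h : SquareTTPrimePinnedPairRowU UA UB s cA cB flA flB βA κA κA' slA βB κB κB' slB n₀ S Λ X)
    (hAB : UA < UB) (hκA : 0 ≤ κA) (hκA' : 0 ≤ κA') (hκB : 0 ≤ κB) (hκB' : 0 ≤ κB')
    {flo cap : ℝ → ℝ → ℝ} {dhi F : ℚ}
    (hcap : ∀ U ∈ Set.Icc UA UB, ∀ s' ∈ Set.Icc s s, (UB - UA) * cap U s' ≤ (UB - U) * ((cA : ℚ) : ℝ) + (U - UA) * ((cB : ℚ) : ℝ))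
    (hflo : ∀ U ∈ Set.Icc UA UB, ∀ s' ∈ Set.Icc s s, (UB - U) * ((flA : ℚ) : ℝ) + (U - UA) * ((flB : ℚ) : ℝ) ≤ (UB - UA) * flo U s')
    {L : ℝ}
    (hLdef : L = (UB - UA) * max ((((κB - κA) - (κB' - κA') : ℚ) : ℝ) * 0) ((((κB - κA) - (κB' - κA') : ℚ) : ℝ) * ((dhi : ℚ) : ℝ)) -
          ((((κB - κA) * (cB - cA) + (κB' - κA') * (-(flB - flA)) : ℚ)) : ℝ))
    (hL : 0 < L) (hF : ((F : ℚ) : ℝ) ≤ ((βA : ℚ) : ℝ) - (L - (((βB : ℚ) : ℝ) - ((βA : ℚ) : ℝ))) ^ 2 / (4 * L)) :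
    SquareTTPrimeBundleOrbitLowerRowWND UA UB s s flo cap dhi F slA slB n₀ S Λ X :=
  h.bundleWND hAB hκA hκA' hκB hκB' hcap hflo fun w _ _ => by
    rw [← hLdef]; exact hF.trans (pinnedPair_segFloor_le _ _ L w hL)

/-- **VERTEX KIND (concave).** As `bundleWND`, with `L ≤ 0` and `F ≤ min βA βB`. [cite: BoydVandenberghe2004, §5.9] -/
theorem SquareTTPrimePinnedPairRowU.bundleWND_vertex
    (h : SquareTTPrimePinnedPairRowU UA UB s cA cB flA flB βA κA κA' slA βB κB κB' slB n₀ S Λ X)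
    (hAB : UA < UB) (hκA : 0 ≤ κA) (hκA' : 0 ≤ κA') (hκB : 0 ≤ κB) (hκB' : 0 ≤ κB')
    {flo cap : ℝ → ℝ → ℝ} {dhi F : ℚ}
    (hcap : ∀ U ∈ Set.Icc UA UB, ∀ s' ∈ Set.Icc s s, (UB - UA) * cap U s' ≤ (UB - U) * ((cA : ℚ) : ℝ) + (U - UA) * ((cB : ℚ) : ℝ))
    (hflo : ∀ U ∈ Set.Icc UA UB, ∀ s' ∈ Set.Icc s s, (UB - U) * ((flA : ℚ) : ℝ) + (U - UA) * ((flB : ℚ) : ℝ) ≤ (UB - UA) * flo U s')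
    {L : ℝ}
    (hLdef : L = (UB - UA) * max ((((κB - κA) - (κB' - κA') : ℚ) : ℝ) * 0) ((((κB - κA) - (κB' - κA') : ℚ) : ℝ) * ((dhi : ℚ) : ℝ)) -
          ((((κB - κA) * (cB - cA) + (κB' - κA') * (-(flB - flA)) : ℚ)) : ℝ))
    (hL : L ≤ 0) (hF : F ≤ min βA βB) :
    SquareTTPrimeBundleOrbitLowerRowWND UA UB s s flo cap dhi F slA slB n₀ S Λ X :=
  h.bundleWND hAB hκA hκA' hκB hκB' hcap hflo fun w hw0 hw1 => by
    rw [← hLdef]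
    have hF' : ((F : ℚ) : ℝ) ≤ min ((βA : ℚ) : ℝ) ((βB : ℚ) : ℝ) :=
      le_min (by exact_mod_cast hF.trans (min_le_left _ _)) (by exact_mod_cast hF.trans (min_le_right _ _))
    exact hF'.trans (pinnedPair_endpointFloor_le _ _ L w hL hw0 hw1)

end Kinds

end Summit.Ventures.CertifiedManyBodySolver

end
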